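/-
Origin: expansion seat `planner-pub-hodgecm-mc-glue-1-0`, handover #27 2026-08-18T19:00Z md5 2412b16b71a1b0869b55da4b33375531 (NEW additive leaf, 285 l.; = claimed a566fcd66d39 with the ONE import line rewritten Literature.MeasureTheory.Group.CosetSpaceLpTransport -> HodgeCM.Vendored.H21.MeasureTheory.Group.CosetSpaceLpTransport, no other change; INSTALL ONLY WITH/AFTER packet-1 rows #2-#12 (needs vendored CosetSpaceLpTransport); imports HodgeCM.Automorphic.Adeli (`HOME/mc/pub-hodgecm-mc-glue-1/aslanded/HodgeCM/Model/Junction/QuotientModelTransport.lean`, md5 2412b16b, 285 lines);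
landed by the packager successor (mc-unitary-1-g3, gen-8 kit) in gate run 32 as `HodgeCM/Model/Junction/QuotientModelTransport.lean` (verbatim).
-/
/-
Origin: pub-hodgecm cell, node E-J (junction J2 of E2-INSTANCE-SPEC-prl1 §3), seat mc-glue-1.
Target: HodgeCM/Model/Junction/QuotientModelTransport.lean (NEW additive leaf).
VENDORING NOTE (P0): the second import is the TREE module
`Literature.MeasureTheory.Group.CosetSpaceLpTransport` (J2a); after vendoring it reads
`HodgeCM.Vendored.H21.MeasureTheory.Group.CosetSpaceLpTransport`.
-/
import Summits.HodgeConjecture.HodgeCM.Automorphic.AdelicUnitaryModel_2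
import Summits.HodgeConjecture.HodgeCM.Automorphic.ModelAnnihilation
import Literature.MeasureTheory.Group.CosetSpaceLpTransport

/-!
# J2 — transporting the `L²`-carrier of a quotient model along a group isomorphism

For a quotient model `Q : QuotientModel` (carrier `Q.H = L²(Q.G ⧸ Q.Γ, Q.ν)`, representation
`Q.R = ρHom Q.ν`) and a topological-group isomorphism `e : G₁ ≃ₜ* Q.G` carrying a subgroup
`Γ₁ ≤ G₁` onto `Q.Γ`, this file provides — with NO hypothesis beyond the data —

* `Q.pullbackν Γ₁ e hΓ` : the folded measure `Q.ν` pulled back to `G₁ ⧸ Γ₁` (finite,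
  `G₁`-invariant), together with its honest description as the folded measure of the pulled-back
  Haar data `(Q.μ ∘ e, e⁻¹(Q.𝓕))` (`pullbackν_eq_map_mk_restrict`, `isHaarMeasure_pullbackμ`,
  `isFundamentalDomain_pullback𝓕`) — so every tree lemma stated for `π_*(μ|𝓕)` with
  `IsFundamentalDomain Γ.op 𝓕 μ` applies VERBATIM on the `G₁`-side;
* `Q.transportL2 Γ₁ e hΓ : L²(G₁ ⧸ Γ₁, pullbackν) ≃ₗᵢ[ℂ] Q.H`, the isometric, `ℂ`-linear,
  surjective transport `f ↦ f ∘ (cosetCongr e)⁻¹`, and its EQUIVARIANCE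
  `transportL2 (ρ g f) = Q.R (e g) (transportL2 f)` (`transportL2_ρ`);
* `Q.transportEmb … emb₁ := transportL2 ∘ emb₁` for a linear map `emb₁ : X →ₗ[ℂ] L²(G₁ ⧸ Γ₁)`,
  with `inner`/`norm` preservation (`inner_transportEmb`, `norm_transportEmb`);
* the REGIME specialisation to `Q := (V.latticeModel hP).toQuotientModel`,
  `e := Adelic.regimeEquiv L V.Hm h` (`HermSpace3.regimeTransportL2`, `…_ρ`): in PerL's regime
  (`IsAnisotropic L V.Hm`, e.g. `4 ≤ [L:ℚ]`) the END-STATE Hilbert space receives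
  `L²(U(V)(𝔸) ⧸ U(V)(L), pullbackν)` isometrically and `U(V)(𝔸)`-equivariantly.

This is the junction through which node E feeds the tree-side constructions over
`adelicUnitaryGroup L V.Hm` (D1-aut `emb`, D1-G `cover`, theta kernels) into the package fields
`AdelicThetaCore.emb/cover` WITHOUT restating them. Everything here is `[folklore]` measure
theory (transport of structure); 0 named facts, 0 hypotheses.
-/

noncomputable section

open MeasureTheory Literature.MeasureTheory.Group
open scoped ENNReal

namespace HodgeCM

namespace QuotientModel

open HodgeCM.PerL34 HodgeCM.PerL34.QuotientSmoothing

variable (Q : QuotientModel) {G₁ : Type*} [Group G₁] [TopologicalSpace G₁]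
  (Γ₁ : Subgroup G₁) [MeasurableSpace (G₁ ⧸ Γ₁)] [BorelSpace (G₁ ⧸ Γ₁)]
  (e : G₁ ≃ₜ* Q.G) (hΓ : ∀ g, e g ∈ Q.Γ ↔ g ∈ Γ₁)

/-! ## 1. The pulled-back folded measure on `G₁ ⧸ Γ₁` -/

/-- **`Q.ν` pulled back along `cosetCongr e : G₁ ⧸ Γ₁ ≃ Q.G ⧸ Q.Γ`.** [folklore] -/
def pullbackν : Measure (G₁ ⧸ Γ₁) := cosetPullback e.toMulEquiv Γ₁ Q.Γ hΓ Q.ν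

omit [BorelSpace (G₁ ⧸ Γ₁)] in
/-- (Ported verbatim from the HodgeCMPerL package; no docstring in the source.) -/
theorem pullbackν_def : Q.pullbackν Γ₁ e hΓ = cosetPullback e.toMulEquiv Γ₁ Q.Γ hΓ Q.ν := rfl

/-- (Ported verbatim from the HodgeCMPerL package; no docstring in the source.) -/
instance isFiniteMeasure_pullbackν : IsFiniteMeasure (Q.pullbackν Γ₁ e hΓ) :=
  isFiniteMeasure_cosetPullback e.toMulEquiv Γ₁ Q.Γ hΓ Q.ν

/-- (Ported verbatim from the HodgeCMPerL package; no docstring in the source.) -/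
instance smulInvariantMeasure_pullbackν [IsTopologicalGroup G₁] :
    SMulInvariantMeasure G₁ (G₁ ⧸ Γ₁) (Q.pullbackν Γ₁ e hΓ) :=
  smulInvariantMeasure_cosetPullback e.toMulEquiv Γ₁ Q.Γ hΓ e.symm.continuous Q.ν

/-- total mass is preserved -/
theorem pullbackν_univ : Q.pullbackν Γ₁ e hΓ Set.univ = Q.ν Set.univ :=
  cosetPullback_univ e.toMulEquiv Γ₁ Q.Γ hΓ e.symm.continuous Q.ν

/-- `cosetCongr e` is measure preserving from the pull-back to `Q.ν`. [folklore] -/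
theorem measurePreserving_cosetCongr_pullbackν :
    MeasurePreserving (cosetCongr e.toMulEquiv Γ₁ Q.Γ hΓ) (Q.pullbackν Γ₁ e hΓ) Q.ν :=
  measurePreserving_cosetCongr_cosetPullback e.toMulEquiv Γ₁ Q.Γ hΓ e.continuous
    e.symm.continuous Q.ν

section HaarData

variable [MeasurableSpace G₁] [BorelSpace G₁]

/-- The pulled-back Haar measure `Q.μ ∘ e` on `G₁`. [folklore] -/
def pullbackμ : Measure G₁ := Q.μ.map e.symm

omit [BorelSpace G₁] in
/-- (Ported verbatim from the HodgeCMPerL package; no docstring in the source.) -/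
theorem pullbackμ_def : Q.pullbackμ e = Q.μ.map e.symm := rfl

/-- (Ported verbatim from the HodgeCMPerL package; no docstring in the source.) -/
instance isHaarMeasure_pullbackμ [IsTopologicalGroup G₁] : (Q.pullbackμ e).IsHaarMeasure :=
  e.symm.toMulEquiv.isHaarMeasure_map Q.μ e.symm.continuous e.continuous

include hΓ in
omit [MeasurableSpace (G₁ ⧸ Γ₁)] [BorelSpace (G₁ ⧸ Γ₁)] in
/-- The pulled-back fundamental domain `e⁻¹(Q.𝓕)` is a fundamental domain for `Γ₁` acting on the
right of `(G₁, Q.μ ∘ e)`. [folklore] -/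
theorem isFundamentalDomain_pullback𝓕 :
    IsFundamentalDomain Γ₁.op (e ⁻¹' Q.𝓕) (Q.pullbackμ e) := by
  have h := isFundamentalDomain_image_mulEquiv e.symm.toMulEquiv e.symm.continuous.measurable
    e.continuous.measurable Q.Γ Γ₁ (forall_symm_mem_iff e.toMulEquiv Γ₁ Q.Γ hΓ)
    Q.isFundamentalDomain
  rwa [show (e.symm.toMulEquiv : Q.G → G₁) '' Q.𝓕 = e ⁻¹' Q.𝓕 from
    (e.toEquiv.image_symm_eq_preimage Q.𝓕)] at h

/-- **The pull-back of `Q.ν` IS the folded measure of the pulled-back Haar data**: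
`pullbackν = π_*((Q.μ ∘ e)|e⁻¹(Q.𝓕))`. [folklore] -/
theorem pullbackν_eq_map_mk_restrict :
    Q.pullbackν Γ₁ e hΓ =
      ((Q.pullbackμ e).restrict (e ⁻¹' Q.𝓕)).map (QuotientGroup.mk : G₁ → G₁ ⧸ Γ₁) :=
  cosetPullback_map_mk_restrict e.toMulEquiv Γ₁ Q.Γ hΓ e.continuous e.symm.continuous Q.μ Q.𝓕

end HaarData

/-! ## 2. The `L²` transport and its equivariance -/

/-- **`L²(G₁ ⧸ Γ₁, pullbackν) ≃ₗᵢ[ℂ] Q.H`**, `f ↦ f ∘ (cosetCongr e)⁻¹`. [folklore] -/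
def transportL2 : Lp ℂ 2 (Q.pullbackν Γ₁ e hΓ) ≃ₗᵢ[ℂ] Q.H :=
  (lpCosetCongr e.toMulEquiv Γ₁ Q.Γ hΓ e.continuous e.symm.continuous ℂ 2 ℂ Q.ν).symm

/-- (Ported verbatim from the HodgeCMPerL package; no docstring in the source.) -/
theorem transportL2_symm_eq :
    (Q.transportL2 Γ₁ e hΓ).symm =
      lpCosetCongr e.toMulEquiv Γ₁ Q.Γ hΓ e.continuous e.symm.continuous ℂ 2 ℂ Q.ν := rfl

/-- `transportL2 f = f ∘ cosetCongr e⁻¹` a.e. [folklore] -/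
theorem coeFn_transportL2 (f : Lp ℂ 2 (Q.pullbackν Γ₁ e hΓ)) :
    (Q.transportL2 Γ₁ e hΓ f : Q.G ⧸ Q.Γ → ℂ) =ᵐ[Q.ν]
      (f : G₁ ⧸ Γ₁ → ℂ) ∘ cosetCongr e.symm.toMulEquiv Q.Γ Γ₁
        (forall_symm_mem_iff e.toMulEquiv Γ₁ Q.Γ hΓ) :=
  coeFn_lpCosetCongr_symm e.toMulEquiv Γ₁ Q.Γ hΓ e.continuous e.symm.continuous f

/-- `transportL2⁻¹ v = v ∘ cosetCongr e` a.e. [folklore] -/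
theorem coeFn_transportL2_symm (v : Q.H) :
    ((Q.transportL2 Γ₁ e hΓ).symm v : G₁ ⧸ Γ₁ → ℂ) =ᵐ[Q.pullbackν Γ₁ e hΓ]
      (v : Q.G ⧸ Q.Γ → ℂ) ∘ cosetCongr e.toMulEquiv Γ₁ Q.Γ hΓ :=
  coeFn_lpCosetCongr e.toMulEquiv Γ₁ Q.Γ hΓ e.continuous e.symm.continuous v

/-- (Ported verbatim from the HodgeCMPerL package; no docstring in the source.) -/
theorem norm_transportL2 (f : Lp ℂ 2 (Q.pullbackν Γ₁ e hΓ)) :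
    ‖Q.transportL2 Γ₁ e hΓ f‖ = ‖f‖ :=
  (Q.transportL2 Γ₁ e hΓ).norm_map f

/-- (Ported verbatim from the HodgeCMPerL package; no docstring in the source.) -/
theorem inner_transportL2 (f g : Lp ℂ 2 (Q.pullbackν Γ₁ e hΓ)) :
    inner ℂ (Q.transportL2 Γ₁ e hΓ f) (Q.transportL2 Γ₁ e hΓ g) = inner ℂ f g :=
  (Q.transportL2 Γ₁ e hΓ).inner_map_map f g

variable [IsTopologicalGroup G₁]

/-- **Equivariance**: `transportL2 (ρ(g) f) = R(e g) (transportL2 f)` — the transport intertwines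
the quasi-regular representation of `G₁` on `L²(G₁ ⧸ Γ₁, pullbackν)` with the model
representation `Q.R` through `e`. [folklore] -/
theorem transportL2_ρ (g : G₁) (f : Lp ℂ 2 (Q.pullbackν Γ₁ e hΓ)) :
    Q.transportL2 Γ₁ e hΓ (ρ (Q.pullbackν Γ₁ e hΓ) g f) = Q.R (e g) (Q.transportL2 Γ₁ e hΓ f) := by
  set T := lpCosetCongr e.toMulEquiv Γ₁ Q.Γ hΓ e.continuous e.symm.continuous ℂ 2 ℂ Q.ν
  have hT : ∀ v : Q.H, T (Q.R (e g) v) = ρ (Q.pullbackν Γ₁ e hΓ) g (T v) := fun v =>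
    lpCosetCongr_translate e.toMulEquiv Γ₁ Q.Γ hΓ e.continuous e.symm.continuous g
      (A := fun v : Q.H => Q.R (e g) v) (B := fun w => ρ (Q.pullbackν Γ₁ e hΓ) g w)
      (fun v => coeFn_ρ Q.ν (e g) v) (fun w => coeFn_ρ (Q.pullbackν Γ₁ e hΓ) g w) v
  have h := hT (T.symm f)
  rw [LinearIsometryEquiv.apply_symm_apply] at h
  change T.symm _ = _
  rw [← h, LinearIsometryEquiv.symm_apply_apply]
  rfl

/-- The same with `Q.R` unfolded to `ρ Q.ν`. -/
theorem transportL2_ρ' (g : G₁) (f : Lp ℂ 2 (Q.pullbackν Γ₁ e hΓ)) :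
    Q.transportL2 Γ₁ e hΓ (ρ (Q.pullbackν Γ₁ e hΓ) g f) = ρ Q.ν (e g) (Q.transportL2 Γ₁ e hΓ f) :=
  Q.transportL2_ρ Γ₁ e hΓ g f

/-- Equivariance read backwards: `transportL2⁻¹ (R(e g) v) = ρ(g) (transportL2⁻¹ v)`. -/
theorem transportL2_symm_R (g : G₁) (v : Q.H) :
    (Q.transportL2 Γ₁ e hΓ).symm (Q.R (e g) v) =
      ρ (Q.pullbackν Γ₁ e hΓ) g ((Q.transportL2 Γ₁ e hΓ).symm v) := by
  apply (Q.transportL2 Γ₁ e hΓ).injective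
  rw [LinearIsometryEquiv.apply_symm_apply, transportL2_ρ, LinearIsometryEquiv.apply_symm_apply]

/-- Equivariance at a point of `Q.G`: `R(g') ∘ transportL2 = transportL2 ∘ ρ(e⁻¹ g')`. -/
theorem R_transportL2 (g' : Q.G) (f : Lp ℂ 2 (Q.pullbackν Γ₁ e hΓ)) :
    Q.R g' (Q.transportL2 Γ₁ e hΓ f) = Q.transportL2 Γ₁ e hΓ (ρ (Q.pullbackν Γ₁ e hΓ) (e.symm g') f) := by
  rw [transportL2_ρ, ContinuousMulEquiv.apply_symm_apply]

/-! ## 3. Transporting an embedding `X →ₗ[ℂ] L²(G₁ ⧸ Γ₁)` into `Q.H` -/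

section Emb

variable {X : Type*} [AddCommGroup X] [Module ℂ X] (emb₁ : X →ₗ[ℂ] Lp ℂ 2 (Q.pullbackν Γ₁ e hΓ))

omit [IsTopologicalGroup G₁] in
/-- **`transportEmb emb₁ := transportL2 ∘ emb₁ : X →ₗ[ℂ] Q.H`.** [folklore] -/
def transportEmb : X →ₗ[ℂ] Q.H :=
  (Q.transportL2 Γ₁ e hΓ).toLinearEquiv.toLinearMap ∘ₗ emb₁

omit [IsTopologicalGroup G₁] in
/-- (Ported verbatim from the HodgeCMPerL package; no docstring in the source.) -/
@[simp]
theorem transportEmb_apply (x : X) :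
    Q.transportEmb Γ₁ e hΓ emb₁ x = Q.transportL2 Γ₁ e hΓ (emb₁ x) := rfl

omit [IsTopologicalGroup G₁] in
/-- (Ported verbatim from the HodgeCMPerL package; no docstring in the source.) -/
theorem inner_transportEmb (x y : X) :
    inner ℂ (Q.transportEmb Γ₁ e hΓ emb₁ x) (Q.transportEmb Γ₁ e hΓ emb₁ y) =
      inner ℂ (emb₁ x) (emb₁ y) :=
  Q.inner_transportL2 Γ₁ e hΓ _ _

omit [IsTopologicalGroup G₁] in
/-- (Ported verbatim from the HodgeCMPerL package; no docstring in the source.) -/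
theorem norm_transportEmb (x : X) : ‖Q.transportEmb Γ₁ e hΓ emb₁ x‖ = ‖emb₁ x‖ :=
  Q.norm_transportL2 Γ₁ e hΓ _

omit [IsTopologicalGroup G₁] in
/-- (Ported verbatim from the HodgeCMPerL package; no docstring in the source.) -/
theorem transportEmb_injective_iff :
    Function.Injective (Q.transportEmb Γ₁ e hΓ emb₁) ↔ Function.Injective emb₁ := by
  constructor
  · intro h x y hxy
    exact h (by simp only [transportEmb_apply, hxy])
  · intro h x y hxy
    exact h ((Q.transportL2 Γ₁ e hΓ).injective (by simpa only [transportEmb_apply] using hxy))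

omit [IsTopologicalGroup G₁] in
/-- (Ported verbatim from the HodgeCMPerL package; no docstring in the source.) -/
theorem range_transportEmb :
    LinearMap.range (Q.transportEmb Γ₁ e hΓ emb₁) =
      (LinearMap.range emb₁).map (Q.transportL2 Γ₁ e hΓ).toLinearEquiv.toLinearMap := by
  rw [transportEmb, LinearMap.range_comp]

/-- Equivariance of a transported embedding: if `emb₁` intertwines an action `a` of `G₁` on `X`
with `ρ`, then `transportEmb emb₁` intertwines `a` with `Q.R ∘ e`. [folklore] -/
theorem transportEmb_equivariant {a : G₁ → X → X}
    (hemb : ∀ (g : G₁) (x : X), emb₁ (a g x) = ρ (Q.pullbackν Γ₁ e hΓ) g (emb₁ x)) (g : G₁) (x : X) :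
    Q.transportEmb Γ₁ e hΓ emb₁ (a g x) = Q.R (e g) (Q.transportEmb Γ₁ e hΓ emb₁ x) := by
  rw [transportEmb_apply, transportEmb_apply, hemb, transportL2_ρ]

end Emb

end QuotientModel

/-! ## 4. The regime specialisation: `U(V)(𝔸) ⧸ U(V)(L)` into the END-STATE carrier -/

namespace HermSpace3

open HodgeCM.Adelic HodgeCM.PerL34 HodgeCM.PerL34.QuotientSmoothing

variable (hP : PrintFact_unitaryCompact) {L : CMField} {ι₁ : L →+* ℂ} (V : HermSpace3 L ι₁)
  (h : IsAnisotropic L V.Hm)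

/-- In the regime, `regimeEquiv` carries `U(V)(L)` onto the model lattice (by `Iff.rfl`). -/
theorem regimeEquiv_mem_latticeModel_Γ_iff (g : adelicUnitaryGroup L V.Hm) :
    regimeEquiv L V.Hm h g ∈ (V.latticeModel hP).toQuotientModel.Γ ↔ g ∈ adelicUnitaryRat L V.Hm :=
  Iff.rfl

/-- With `4 ≤ [L : ℚ]` the regime hypothesis is automatic (`V.isAnisotropic h4`) and
`regimeEquiv = V.latticeModelEquiv hP h4` definitionally. -/
example (h4 : 4 ≤ Module.finrank ℚ L) :
    V.latticeModelEquiv hP h4 = regimeEquiv L V.Hm (V.isAnisotropic h4) := rfl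

variable [MeasurableSpace (adelicUnitaryGroup L V.Hm ⧸ adelicUnitaryRat L V.Hm)]
  [BorelSpace (adelicUnitaryGroup L V.Hm ⧸ adelicUnitaryRat L V.Hm)]

/-- **The folded measure of the END-STATE model pulled back to `U(V)(𝔸) ⧸ U(V)(L)`.** [folklore] -/
def regimeν : Measure (adelicUnitaryGroup L V.Hm ⧸ adelicUnitaryRat L V.Hm) :=
  (V.latticeModel hP).toQuotientModel.pullbackν (adelicUnitaryRat L V.Hm) (regimeEquiv L V.Hm h)
    (V.regimeEquiv_mem_latticeModel_Γ_iff hP h)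

/-- (Ported verbatim from the HodgeCMPerL package; no docstring in the source.) -/
instance isFiniteMeasure_regimeν : IsFiniteMeasure (V.regimeν hP h) := by
  unfold regimeν; infer_instance

/-- (Ported verbatim from the HodgeCMPerL package; no docstring in the source.) -/
instance smulInvariantMeasure_regimeν :
    SMulInvariantMeasure (adelicUnitaryGroup L V.Hm) (adelicUnitaryGroup L V.Hm ⧸ adelicUnitaryRat L V.Hm)
      (V.regimeν hP h) := by
  unfold regimeν; infer_instance

/-- **The END-STATE carrier `(V.latticeModel hP).toQuotientModel.H` receives
`L²(U(V)(𝔸) ⧸ U(V)(L), regimeν)` isometrically.** [folklore] -/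
def regimeTransportL2 :
    Lp ℂ 2 (V.regimeν hP h) ≃ₗᵢ[ℂ] (V.latticeModel hP).toQuotientModel.H :=
  (V.latticeModel hP).toQuotientModel.transportL2 (adelicUnitaryRat L V.Hm) (regimeEquiv L V.Hm h)
    (V.regimeEquiv_mem_latticeModel_Γ_iff hP h)

/-- … and `U(V)(𝔸)`-equivariantly: `T (ρ(g) f) = R(regimeEquiv g) (T f)`. [folklore] -/
theorem regimeTransportL2_ρ (g : adelicUnitaryGroup L V.Hm) (f : Lp ℂ 2 (V.regimeν hP h)) :
    V.regimeTransportL2 hP h (ρ (V.regimeν hP h) g f) =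
      (V.latticeModel hP).toQuotientModel.R (regimeEquiv L V.Hm h g) (V.regimeTransportL2 hP h f) :=
  QuotientModel.transportL2_ρ _ _ _ _ g f

end HermSpace3

end HodgeCM

end

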